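import Mathlib
import Summits.BirchSwinnertonDyer.BirchSwinnertonDyer.Theorems.GenusKolyvaginAtTwoGenusPrimitiveSupplyAtTwoHeegnerNonTorsion
import Literature.NumberTheory.EllipticCurves.AnalyticRankModularityProofs
import Literature.NumberTheory.EllipticCurves.BSDRootNumberNoContinuationProofs
import Literature.NumberTheory.EllipticCurves.AnalyticRankOrderProofs
import HarnessLib

/-!
# Route `GenusKolyvaginAtTwo`, crux `GenusPrimitiveSupplyAtTwo` (stmt-BirchSwinnertonDyer-22136), line `genus-supply`:
# stub B `stub_heegnerNonTorsionAtTwo` CLOSED MODULO `gross_zagier` ALONE — the modularity binder is discharged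

Cell `bsd-f1-sign2`, seat `bsd-line-gk2-p4` (prover seat 4, WIDTH-5 attach; LEAD of the line is gk2-p1). Helper for the
crux item (`--supports stmt-BirchSwinnertonDyer-22136`, helper mode). The LEAD closed stub B modulo TWO named facts
(`Theorems/…GenusPrimitiveSupplyAtTwoHeegnerNonTorsion.lean`, `stub_heegnerNonTorsionAtTwo_of_published`, p580851):
modularity `hasEntireLFunction_rat` («every `E/ℚ` has an entire `L`-function», BCDT) and the Gross–Zagier formula
`gross_zagier`. This file removes the first: the stub's OWN binders already make both `L`-functions of the pair
`(E, E^{(d_K)})` entire —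
* `L(E, s)` because the stub hands us a modular parametrisation datum `Dt : ModularParametrizationData W N_E`, whose
  newform `Dt.f` has `a_n(f) = a_n(E)` (`Dt.isNewformOf`), and a weight-`2` cusp form's `L`-series is entire
  (Diamond–Shurman Thm. 5.10.2, tree theorem `WeierstrassCurve.hasEntireLFunction_of_cuspCoeff_eq`);
* `L(E^{(d_K)}, s)` because the stub ASSUMES `r_an(E^{(d_K)}) = 1 ≠ 0`, and the tree's analytic rank is `0` in the
  no-continuation junk branch (`WeierstrassCurve.hasEntireLFunction_of_analyticRank_ne_zero`), so a non-zero analytic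
  rank certifies the continuation by itself.
Hence `ord_{s=1} L(E/K, s) = r_an(E) + r_an(E^{(d_K)}) = 0 + 1 = 1` for THIS pair without any global modularity
hypothesis (`analyticRankEK_eq_add_of_hasEntireLFunction`, the per-pair form of the tree's `analyticRankEK_eq_add_of`),
and the LEAD's argument runs unchanged: `L'(E/K,1) ≠ 0` (`LDerivEK_ne_zero_of_analyticRankEK_eq_one`), the Heegner point
`P₀ ∈ E(K)` under `P(1)` (PROVED descent `heegnerSystem_exists_isHeegnerPoint_map_eq_derivedPoint_one` with Shimura
reciprocity `heegnerPointOfConductor_one_galoisConj_holds`) has infinite order by Gross–Zagier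
(`lDerivEK_ne_zero_iff_not_isOfFinAddOrder`, the one remaining named fact `gross_zagier N_E W K`), and `E(K) → E(K[1])` is
injective. RESULT: stub B's trust base shrinks from {`hasEntireLFunction_rat`, `gross_zagier`} to {`gross_zagier`} —
`stub_heegnerNonTorsionAtTwo_of_grossZagier` has the REGISTERED signature of `stub_heegnerNonTorsionAtTwo` verbatim after
ONE fact binder. No summit, no leaf and no crux is proved by this file; BSD is not proved by any of this.

References: Gross–Zagier, Invent. Math. 84 (1986) Thm. I.6.3, V.§2, I.§7 [GrossZagier1986]; Gross, in *L-functions and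
Arithmetic* (1991) §§1, 4 [GrossLMS1991]; Diamond–Shurman, *A First Course in Modular Forms* (2005) Thm. 5.10.2
[DiamondShurman2005]; Breuil–Conrad–Diamond–Taylor, JAMS 14 (2001) [BreuilConradDiamondTaylor2001].
-/

set_option linter.dupNamespace false -- tree convention: `Summit.BirchSwinnertonDyer.BirchSwinnertonDyer.Theorems` (summit = sub-problem)

noncomputable section

open scoped Classical

namespace Summit.BirchSwinnertonDyer.BirchSwinnertonDyer.Theorems.GenusKoly

open WeierstrassCurve Literature.NumberTheory.EllipticCurves Literature.NumberTheory.EllipticCurves.ModularForms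

/-! ## §1 Orders of vanishing add, per pair -/

/-- **`ord_{s=1} L(E/K,s) = r_an(E) + r_an(E^{(d_K)})` for ONE pair**, assuming only that `L(E,s)` and
`L(E^{(d_K)},s)` have entire continuations (then both are analytic and not identically zero near `1`,
`analyticOrderAt_entireLFunction_ne_top`, and orders of vanishing of analytic germs add, Mathlib `analyticOrderNatAt_mul`).
The per-pair form of the tree's `analyticRankEK_eq_add_of` (which assumes `hasEntireLFunction_rat` for every curve).
Gross–Zagier 1986, I.§7. [cite: GrossZagier1986, I.§7] -/
theorem analyticRankEK_eq_add_of_hasEntireLFunction (W : WeierstrassCurve ℚ) [W.IsElliptic]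
    (K : Type*) [Field K] [NumberField K] (hW : W.HasEntireLFunction)
    (hW' : (W.quadraticTwist (NumberField.discr K : ℚ)).HasEntireLFunction) :
    analyticRankEK W K = W.analyticRank + (W.quadraticTwist (NumberField.discr K : ℚ)).analyticRank := by
  have hd : (NumberField.discr K : ℚ) ≠ 0 := by exact_mod_cast NumberField.discr_ne_zero K
  haveI := W.isElliptic_quadraticTwist hd
  set W' := W.quadraticTwist (NumberField.discr K : ℚ) with hW'def
  have hf : AnalyticAt ℂ W.entireLFunction 1 := (W.differentiable_entireLFunction hW).analyticAt 1
  have hg : AnalyticAt ℂ W'.entireLFunction 1 := (W'.differentiable_entireLFunction hW').analyticAt 1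
  show analyticOrderNatAt (W.entireLFunction * W'.entireLFunction) 1 = _
  exact analyticOrderNatAt_mul hf hg (W.analyticOrderAt_entireLFunction_ne_top hW)
    (W'.analyticOrderAt_entireLFunction_ne_top hW')

/-! ## §2 Both `L`-functions of the stub's pair are entire, from the stub's own binders -/

/-- **A modular parametrisation datum makes `L(E,s)` entire.** `Dt.f` is a weight-`2` newform on `Γ₀(N)` with
`a_n(f) = a_n(E)` for all `n` (`Dt.isNewformOf`); its `L`-series is entire and agrees with `L(E,s)` on `Re s > 3/2`
(Diamond–Shurman Thm. 5.10.2 / 8.8.3; tree `WeierstrassCurve.hasEntireLFunction_of_cuspCoeff_eq`).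
[cite: DiamondShurman2005, Thm. 5.10.2 and Thm. 8.8.3] -/
theorem hasEntireLFunction_of_datum (W : WeierstrassCurve ℚ) {N : ℕ} [NeZero N]
    (Dt : ModularParametrizationData W N) : W.HasEntireLFunction :=
  WeierstrassCurve.hasEntireLFunction_of_cuspCoeff_eq (CongruenceSubgroup.strictWidthInfty_Gamma0 _) W Dt.f
    Dt.isNewformOf.2

/-- **`ord_{s=1} L(E/K,s) = 1` for the stub's pair**, with NO modularity fact: `L(E,s)` is entire by the datum `Dt`
(`hasEntireLFunction_of_datum`), `L(E^{(d_K)},s)` is entire because `r_an(E^{(d_K)}) = 1 ≠ 0` (the tree's analytic rank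
vanishes in the no-continuation branch, `hasEntireLFunction_of_analyticRank_ne_zero`), and orders add (§1):
`0 + 1 = 1`. [cite: GrossZagier1986, I.§7] -/
theorem analyticRankEK_eq_one_of_datum (W : WeierstrassCurve ℚ) [W.IsElliptic] {N : ℕ} [NeZero N]
    (Dt : ModularParametrizationData W N) (K : Type*) [Field K] [NumberField K]
    (hr0 : W.analyticRank = 0) (hr1 : (W.quadraticTwist (NumberField.discr K : ℚ)).analyticRank = 1) :
    analyticRankEK W K = 1 := by
  have hd : (NumberField.discr K : ℚ) ≠ 0 := by exact_mod_cast NumberField.discr_ne_zero K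
  haveI := W.isElliptic_quadraticTwist hd
  have hW' : (W.quadraticTwist (NumberField.discr K : ℚ)).HasEntireLFunction :=
    (W.quadraticTwist (NumberField.discr K : ℚ)).hasEntireLFunction_of_analyticRank_ne_zero
      (by rw [hr1]; exact one_ne_zero)
  rw [analyticRankEK_eq_add_of_hasEntireLFunction W K (hasEntireLFunction_of_datum W Dt) hW', hr0, hr1]

/-! ## §3 Stub B modulo Gross–Zagier alone -/

/-- **`y_K = P(1)` has infinite order when `r_an(E) = 0` and `r_an(E^{(d_K)}) = 1`, modulo the Gross–Zagier formula
ONLY.** As the LEAD's `not_isOfFinAddOrder_derivedPoint_one_of_published`, with its modularity binder `hasEntireLFunction_rat`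
replaced by §2: `ord_{s=1} L(E/K,s) = 1` (`analyticRankEK_eq_one_of_datum`, using the datum `Dt` under `d₁`), so
`L'(E/K,1) ≠ 0`; the Heegner point `P₀ ∈ E(K)` mapping to `P(1)` (Gross 1991 §4, PROVED in the tree from Shimura
reciprocity at conductor `1`) has infinite order by Gross–Zagier (Thm. I.6.3 with V.§2: `hGZ`), and `E(K) → E(K[1])` is
injective. [cite: GrossZagier1986, Thm. I.6.3 with V.§2 and I.§7] [cite: GrossLMS1991, §1 (1.1) and §4 (P_1 = y_K)] -/
theorem not_isOfFinAddOrder_derivedPoint_one_of_grossZagier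
    (W : WeierstrassCurve ℚ) [W.IsElliptic] [NeZero (W.conductorNorm ℤ)]
    (K : Type) [Field K] [NumberField K] (hGZ : gross_zagier (W.conductorNorm ℤ) W K)
    (hK : IsImaginaryQuadratic K) (hH : SatisfiesHeegnerHypothesis (W.conductorNorm ℤ) K)
    (hr0 : W.analyticRank = 0) (hr1 : (W.quadraticTwist (NumberField.discr K : ℚ)).analyticRank = 1)
    {Dt : ModularParametrizationData W (W.conductorNorm ℤ)} {β : ℤ} {ι : K →+* ℂ}
    (d₁ : KolyvaginHeegnerData Dt β ι 1) : ¬ IsOfFinAddOrder d₁.derivedPoint := by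
  have hEK : analyticRankEK W K = 1 := analyticRankEK_eq_one_of_datum W Dt K hr0 hr1
  have hL : LDerivEK W K ≠ 0 := LDerivEK_ne_zero_of_analyticRankEK_eq_one W K hEK
  obtain ⟨P₀, hP₀, hmap⟩ := heegnerSystem_exists_isHeegnerPoint_map_eq_derivedPoint_one
    (heegnerPointOfConductor_one_galoisConj_holds (W.conductorNorm ℤ) W K) hK hH d₁
  have hP₀inf : ¬ IsOfFinAddOrder P₀ :=
    (lDerivEK_ne_zero_iff_not_isOfFinAddOrder W (W.conductorNorm ℤ) K hGZ hK hH hP₀).mp hL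
  intro hfin
  apply hP₀inf
  rw [← hmap] at hfin
  exact (WeierstrassCurve.Affine.Point.map_injective (W' := W) _).isOfFinAddOrder_iff.mp hfin

/-- **Stub B of line `genus-supply`, closed modulo the Gross–Zagier formula alone.** After ONE fact binder
(`gross_zagier` at every `(N_E, W, K)`) the statement is the REGISTERED signature of `stub_heegnerNonTorsionAtTwo`,
verbatim (its `[W.IsGloballyMinimal]` binder is idle and kept for the match). Compare the LEAD's
`stub_heegnerNonTorsionAtTwo_of_published` (two fact binders): the modularity binder `hasEntireLFunction_rat` is gone.
[cite: GrossZagier1986, Thm. I.6.3 with V.§2 and I.§7] [cite: GrossLMS1991, §4 (P_1 = y_K)] -/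
theorem stub_heegnerNonTorsionAtTwo_of_grossZagier
    (hGZ : ∀ (W : WeierstrassCurve ℚ) [NeZero (W.conductorNorm ℤ)] (K : Type) [Field K] [NumberField K],
      gross_zagier (W.conductorNorm ℤ) W K) :
    ∀ (W : WeierstrassCurve ℚ) [W.IsElliptic] [W.IsGloballyMinimal] [NeZero (W.conductorNorm ℤ)]
      (K : Type) [Field K] [NumberField K],
      IsImaginaryQuadratic K → SatisfiesHeegnerHypothesis (W.conductorNorm ℤ) K →
      W.analyticRank = 0 → (W.quadraticTwist (NumberField.discr K : ℚ)).analyticRank = 1 →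
      ∀ (Dt : ModularParametrizationData W (W.conductorNorm ℤ)) (β : ℤ) (ι : K →+* ℂ)
        (d₁ : KolyvaginHeegnerData Dt β ι 1), ¬ IsOfFinAddOrder d₁.derivedPoint :=
  fun W _ _ _ K _ _ hK hH hr0 hr1 _Dt _β _ι d₁ ↦
    not_isOfFinAddOrder_derivedPoint_one_of_grossZagier W K (hGZ W K) hK hH hr0 hr1 d₁

/-- **Per-pair form** (the shape a crux-level closer consumes): for ONE `(E, K)` the single hypothesis is the Gross–Zagier
formula for that pair, `gross_zagier N_E W K`. [cite: GrossZagier1986, Thm. I.6.3 with V.§2 and I.§7] -/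
theorem stub_heegnerNonTorsionAtTwo_pair_of_grossZagier
    (W : WeierstrassCurve ℚ) [W.IsElliptic] [NeZero (W.conductorNorm ℤ)]
    (K : Type) [Field K] [NumberField K] (hGZ : gross_zagier (W.conductorNorm ℤ) W K)
    (hK : IsImaginaryQuadratic K) (hH : SatisfiesHeegnerHypothesis (W.conductorNorm ℤ) K)
    (hr0 : W.analyticRank = 0) (hr1 : (W.quadraticTwist (NumberField.discr K : ℚ)).analyticRank = 1) :
    ∀ (Dt : ModularParametrizationData W (W.conductorNorm ℤ)) (β : ℤ) (ι : K →+* ℂ)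
      (d₁ : KolyvaginHeegnerData Dt β ι 1), ¬ IsOfFinAddOrder d₁.derivedPoint :=
  fun _Dt _β _ι d₁ ↦ not_isOfFinAddOrder_derivedPoint_one_of_grossZagier W K hGZ hK hH hr0 hr1 d₁

end Summit.BirchSwinnertonDyer.BirchSwinnertonDyer.Theorems.GenusKoly

end
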